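import Literature.Geometry.Lorentzian.RelativeDevelopmentGluingCauchy
import Literature.Geometry.Lorentzian.DataEmbeddingNormalSmooth
import Literature.Geometry.Lorentzian.HypersurfaceNaturality
import Literature.Geometry.Lorentzian.CurvatureNaturality
import Literature.Geometry.Lorentzian.LorentzianMetricProofs
import Literature.Geometry.Lorentzian.CauchyDevelopmentRestrict
import HarnessLib

/-!
# Relative gluing of developments: the glued space is a vacuum Cauchy development of the larger
# datum extending the given one and receiving the development of the sub-datum
# (Hawking–Ellis 1973, §7.6; Choquet-Bruhat–Geroch 1969, p. 334; relative form of Sbierski 2016,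
# §3.3)

Final file of the relative gluing construction (`RelativeDevelopmentGluingData`,
`RelativeDevelopmentGluingMetric`, `RelativeDevelopmentGluingCauchy`). For a relative common
development `𝔠 = (U ⊆ M₁, ψ : U → M₂)` over `Φ : N → X` of a Cauchy development `𝒟₁` of data `D₁`
on `N` and a Cauchy development `𝒟₂` of data `D₂` on `X`, WITHOUT corresponding boundary points,
the glued spacetime `(M̃, g̃, T̃)` carries the data embedding `ι̃ = π j₂ ∘ ι₂` of `D₂` with future
unit normal `d(π j₂) ν₂`, inducing `(h₂, k₂)` (naturality of the induced metric and of the second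
fundamental form under the isometric immersion `π j₂`,
`PseudoRiemannianMetric.secondFundamentalForm_comap`, with the smoothness of `ν₂` along `ι₂`,
`DataEmbedding.mdifferentiableAt_embed_normal`), whose image `Σ̃` is a Cauchy hypersurface
(`isCauchyHypersurface_glued`); it is vacuum when `𝒟₁`, `𝒟₂` are (naturality of the Ricci
tensor); `π j₂` embeds `𝒟₂` into it as developments of `D₂`, and `π j₁ : M₁ → M̃` is a smooth
isometric time-orientation preserving open embedding over `Φ` (`π j₁ ∘ ι₁ = ι̃ ∘ Φ`) extending
`ψ` (`π j₁ = π j₂ ∘ ψ` on `U`). This is the manifold `𝓜⁺` of Hawking–Ellis 1973, §7.6, p. 250, in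
the proof that the maximal development of `𝓢` contains that of every `𝓢' ⊆ 𝓢`:

* `RelCommonDevelopment.gluedDataEmbedding`, `gluedCauchyDevelopment`, `inrZ_embeds`,
  `embedsInto_glued`, `inlZ_relative` (the five properties of `π j₁` over `Φ`),
  `inlZ_coe_eq_inrZ_map`;
* `isRicciFlat_gluedMetric`, `VacuumCauchyDevelopment.relGluedVacuumCauchyDevelopment`;
* `VacuumCauchyDevelopment.exists_relative_extension_of_not_hasCorrespondingBoundaryPoints` —
  **the gluing input of the localisation principle**: a vacuum Cauchy development `Z` of `D₂`
  with `𝒟₂ ≼ Z` (by `jZ = π j₂`) and an open embedding `j' = π j₁ : M₁ → Z` over `Φ` with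
  `j' = jZ ∘ ψ` on `U`.

No named facts are introduced (D-0026); the five `def`s have bodies, everything else is proved
(transcribed from `DevelopmentGluing`, the case `D₁ = D₂`, `Φ = id`).

## References

* S. W. Hawking, G. F. R. Ellis, *The large scale structure of space-time*, CUP 1973, §7.6,
  pp. 249–251.
* Y. Choquet-Bruhat, R. Geroch, Comm. Math. Phys. 14 (1969) 329–335, proof of Thm. 3, p. 334.
* J. Sbierski, Ann. Henri Poincaré 17 (2016) 301–329 = arXiv:1309.7591v3, §3.3, proof of Thm. 5.
-/

noncomputable section

open Bundle Set Function Filter TopologicalSpace Topology Manifold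
open scoped Manifold ContDiff Topology
open Literature.Topology.FourManifolds

namespace Literature.Geometry.Lorentzian

universe u

section Developments

variable {n : ℕ} {N : Type u} [TopologicalSpace N] [ChartedSpace (EuclideanSpace ℝ (Fin n)) N]
  [IsManifold (𝓡 n) ∞ N] [ConnectedSpace N] {D₁ : InitialDataSet (𝓡 n) N}
  {X : Type u} [TopologicalSpace X] [ChartedSpace (EuclideanSpace ℝ (Fin n)) X]
  [IsManifold (𝓡 n) ∞ X] [ConnectedSpace X] {D₂ : InitialDataSet (𝓡 n) X}

namespace CauchyDevelopment

namespace RelCommonDevelopment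

variable {𝒟₁ : CauchyDevelopment D₁} {𝒟₂ : CauchyDevelopment D₂} {Φ : N → X}
  (𝔠 : RelCommonDevelopment 𝒟₁ 𝒟₂ Φ)

/-! ### The glued data embedding of the larger datum -/

/-- `π j₂` is differentiable. [folklore] -/
theorem mdifferentiable_inr : MDifferentiable (𝓡 (n + 1)) (𝓡 (n + 1)) 𝔠.inr :=
  𝔠.glueData.contMDiff_inr.mdifferentiable (by simp)

/-- `π j₁` is differentiable. [folklore] -/
theorem mdifferentiable_inl : MDifferentiable (𝓡 (n + 1)) (𝓡 (n + 1)) 𝔠.inl :=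
  𝔠.glueData.contMDiff_inl.mdifferentiable (by simp)

/-- Chain rule for the glued data embedding `ι̃ = π j₂ ∘ ι₂`. [folklore] -/
theorem mfderiv_inr_comp_embed (x : X) (v : TangentSpace (𝓡 n) x) :
    mfderiv (𝓡 n) (𝓡 (n + 1)) (𝔠.inr ∘ 𝒟₂.embed) x v =
      mfderiv (𝓡 (n + 1)) (𝓡 (n + 1)) 𝔠.inr (𝒟₂.embed x)
        (mfderiv (𝓡 n) (𝓡 (n + 1)) 𝒟₂.embed x v) := by
  rw [mfderiv_comp x (𝔠.mdifferentiable_inr _) (𝒟₂.mdifferentiable_embed x)]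
  rfl

/-- `π j₂^* g̃ = g₂` as an equality of fields of bilinear forms. [cite: Sbierski2016AHP, §3.3, proof of Thm. 5 ("this turns `π ∘ j` … into isometries")] -/
theorem pullbackBilin_inr_gluedMetric :
    pullbackBilin (I := 𝓡 (n + 1)) (I' := 𝓡 (n + 1)) 𝔠.inr 𝔠.gluedMetric.val = 𝒟₂.metric.val :=
  funext 𝔠.isIsometricImmersion_inr.2

/-- **The pull-back of the glued metric along `π j₂` is the metric of `𝒟₂`.** [cite: Sbierski2016AHP, §3.3, proof of Thm. 5] -/
theorem comap_gluedMetric_inr :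
    𝔠.gluedMetric.toPseudoRiemannianMetric.comap PseudoRiemannianMetric.contMDiff_pullbackBilin_holds
      𝔠.inr 𝔠.glueData.contMDiff_inr (fun b ↦ (𝔠.mfderiv_inr_bijective b).1) rfl =
      𝒟₂.metric.toPseudoRiemannianMetric :=
  PseudoRiemannianMetric.ext 𝔠.pullbackBilin_inr_gluedMetric

/-- **The pull-back of the glued metric along `π j₁` is the metric of `𝒟₁`.** [cite: Sbierski2016AHP, §3.3, proof of Thm. 5] -/
theorem comap_gluedMetric_inl :
    𝔠.gluedMetric.toPseudoRiemannianMetric.comap PseudoRiemannianMetric.contMDiff_pullbackBilin_holds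
      𝔠.inl 𝔠.glueData.contMDiff_inl (fun a ↦ (𝔠.mfderiv_inl_bijective a).1) rfl =
      𝒟₁.metric.toPseudoRiemannianMetric :=
  PseudoRiemannianMetric.ext (funext 𝔠.isIsometricImmersion_inl.2)

/-- **The glued data embedding** `(M̃, g̃, T̃, ι̃ = π j₂ ∘ ι₂, ν̃ = d(π j₂) ν₂)` of the larger datum
`D₂` (Hawking–Ellis 1973, §7.6, p. 250): a smooth embedding, with future unit normal
`d(π j₂) ν₂`, inducing `h₂` (`ι̃^* g̃ = ι₂^* (π j₂^* g̃) = ι₂^* g₂ = h₂`) and `k₂` (naturality of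
the second fundamental form under the isometric immersion `π j₂`,
`PseudoRiemannianMetric.secondFundamentalForm_comap`, fed with the smoothness of `ν₂` along `ι₂`,
`DataEmbedding.mdifferentiableAt_embed_normal`). Hypothesis: `U` has no corresponding boundary
points (`M̃` Hausdorff). [cite: HawkingEllis1973CUP, §7.6, p. 250] -/
def gluedDataEmbedding (h : ¬ 𝔠.HasCorrespondingBoundaryPoints) : DataEmbedding D₂ where
  toSpacetime := 𝔠.gluedSpacetime h
  embed := 𝔠.inr ∘ 𝒟₂.embed
  isSmoothEmbedding := 𝔠.glueData.isSmoothEmbedding_inr_comp 𝒟₂.isSmoothEmbedding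
  normal := fun x ↦ mfderiv (𝓡 (n + 1)) (𝓡 (n + 1)) 𝔠.inr (𝒟₂.embed x) (𝒟₂.normal x)
  isFutureUnitNormal := by
    refine ⟨⟨fun y v ↦ ?_, fun y ↦ ?_⟩, fun y ↦ ?_⟩
    · change 𝔠.gluedMetric.val (𝔠.inr (𝒟₂.embed y))
        (mfderiv (𝓡 (n + 1)) (𝓡 (n + 1)) 𝔠.inr (𝒟₂.embed y) (𝒟₂.normal y))
        (mfderiv (𝓡 n) (𝓡 (n + 1)) (𝔠.inr ∘ 𝒟₂.embed) y v) = 0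
      rw [𝔠.mfderiv_inr_comp_embed, 𝔠.val_gluedMetric_inr]
      exact 𝒟₂.isFutureUnitNormal.1.1 y v
    · change 𝔠.gluedMetric.val (𝔠.inr (𝒟₂.embed y))
        (mfderiv (𝓡 (n + 1)) (𝓡 (n + 1)) 𝔠.inr (𝒟₂.embed y) (𝒟₂.normal y))
        (mfderiv (𝓡 (n + 1)) (𝓡 (n + 1)) 𝔠.inr (𝒟₂.embed y) (𝒟₂.normal y)) = -1
      rw [𝔠.val_gluedMetric_inr]
      exact 𝒟₂.isFutureUnitNormal.1.2 y
    · exact (𝔠.preservesTimeOrientation_inr h).isFutureDirected_mfderiv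
        𝔠.isIsometricImmersion_inr.2 (𝒟₂.isFutureUnitNormal.2 y)
  induced_h := fun y ↦ by
    change pullbackBilin (I := 𝓡 (n + 1)) (I' := 𝓡 n) (𝔠.inr ∘ 𝒟₂.embed) 𝔠.gluedMetric.val y =
      D₂.h.inner y
    rw [pullbackBilin_comp 𝔠.mdifferentiable_inr 𝒟₂.mdifferentiable_embed,
      𝔠.pullbackBilin_inr_gluedMetric]
    exact 𝒟₂.induced_h y
  induced_k := by
    intro inst y
    haveI hLC : 𝒟₂.metric.toPseudoRiemannianMetric.HasLeviCivita :=
      𝒟₂.metric.toPseudoRiemannianMetric.hasLeviCivita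
    haveI hgcLC : (𝔠.gluedMetric.toPseudoRiemannianMetric.comap
        PseudoRiemannianMetric.contMDiff_pullbackBilin_holds 𝔠.inr 𝔠.glueData.contMDiff_inr
        (fun b ↦ (𝔠.mfderiv_inr_bijective b).1) rfl).HasLeviCivita :=
      PseudoRiemannianMetric.hasLeviCivita _
    have key := PseudoRiemannianMetric.secondFundamentalForm_comap
      𝔠.gluedMetric.toPseudoRiemannianMetric PseudoRiemannianMetric.contMDiff_pullbackBilin_holds
      (Φ := 𝔠.inr) 𝔠.glueData.contMDiff_inr (fun b ↦ (𝔠.mfderiv_inr_bijective b).1) rfl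
      (f := 𝒟₂.embed) (ν := 𝒟₂.normal) (y := y) BoundarylessManifold.isInteriorPoint
      (𝒟₂.toDataEmbedding.mdifferentiableAt_embed_normal y)
    change 𝔠.gluedMetric.toPseudoRiemannianMetric.secondFundamentalForm (𝓡 n) (𝔠.inr ∘ 𝒟₂.embed)
      (fun x ↦ mfderiv (𝓡 (n + 1)) (𝓡 (n + 1)) 𝔠.inr (𝒟₂.embed x) (𝒟₂.normal x)) y = D₂.kBilin y
    rw [← key, PseudoRiemannianMetric.secondFundamentalForm_congr_metric 𝔠.comap_gluedMetric_inr
      hgcLC hLC]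
    exact 𝒟₂.induced_k y

/-- **The glued Cauchy development** of `D₂`: the glued data embedding, whose data hypersurface
`Σ̃ = π j₂(ι₂(X))` is a Cauchy hypersurface of `(M̃, g̃, T̃)` (`isCauchyHypersurface_glued`).
Hawking–Ellis 1973, §7.6, p. 250 (*"`𝓜⁺ … ` would then be a development of `𝓢`"*).
[cite: HawkingEllis1973CUP, §7.6, p. 250] -/
def gluedCauchyDevelopment (h : ¬ 𝔠.HasCorrespondingBoundaryPoints) : CauchyDevelopment D₂ where
  toDataEmbedding := 𝔠.gluedDataEmbedding h
  isCauchyHypersurface := 𝔠.isCauchyHypersurface_glued h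

/-- `π j₂` as a map into the carrier of the glued development (so that statements about it
elaborate against the development's bundled instances). [folklore] -/
def inrZ (h : ¬ 𝔠.HasCorrespondingBoundaryPoints) :
    𝒟₂.carrier → (𝔠.gluedCauchyDevelopment h).carrier := 𝔠.inr

/-- `π j₁` as a map into the carrier of the glued development. [folklore] -/
def inlZ (h : ¬ 𝔠.HasCorrespondingBoundaryPoints) :
    𝒟₁.carrier → (𝔠.gluedCauchyDevelopment h).carrier := 𝔠.inl

/-- `inrZ = π j₂`. [folklore] -/
@[simp]
theorem inrZ_apply (h : ¬ 𝔠.HasCorrespondingBoundaryPoints) (b : 𝒟₂.carrier) :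
    𝔠.inrZ h b = 𝔠.inr b := rfl

/-- `inlZ = π j₁`. [folklore] -/
@[simp]
theorem inlZ_apply (h : ¬ 𝔠.HasCorrespondingBoundaryPoints) (a : 𝒟₁.carrier) :
    𝔠.inlZ h a = 𝔠.inl a := rfl

/-- **`π j₂` embeds `𝒟₂` into the glued development** (smooth open embedding, isometric,
time-orientation preserving, `π j₂ ∘ ι₂ = ι̃`). [cite: HawkingEllis1973CUP, §7.6, p. 250] -/
theorem inrZ_embeds (h : ¬ 𝔠.HasCorrespondingBoundaryPoints) :
    ContMDiff (𝓡 (n + 1)) (𝓡 (n + 1)) ∞ (𝔠.inrZ h) ∧ IsOpenEmbedding (𝔠.inrZ h) ∧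
      𝒟₂.metric.IsIsometricImmersion (𝔠.gluedCauchyDevelopment h).metric.toPseudoRiemannianMetric
        (𝔠.inrZ h) ∧
      𝒟₂.timeOrientation.PreservesTimeOrientation (𝔠.inrZ h)
        (𝔠.gluedCauchyDevelopment h).timeOrientation ∧
      𝔠.inrZ h ∘ 𝒟₂.embed = (𝔠.gluedCauchyDevelopment h).embed :=
  ⟨𝔠.glueData.contMDiff_inr, 𝔠.glueData.isOpenEmbedding_inr, 𝔠.isIsometricImmersion_inr,
    𝔠.preservesTimeOrientation_inr h, rfl⟩

/-- **`𝒟₂` embeds into the glued development** via `π j₂`. [cite: HawkingEllis1973CUP, §7.6, p. 250] -/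
theorem embedsInto_glued (h : ¬ 𝔠.HasCorrespondingBoundaryPoints) :
    𝒟₂.EmbedsInto (𝔠.gluedCauchyDevelopment h) :=
  ⟨𝔠.inrZ h, 𝔠.inrZ_embeds h⟩

/-- **`π j₁ : M₁ → M̃` is a smooth isometric time-orientation preserving open embedding over `Φ`**
into the glued development: `π j₁ ∘ ι₁ = ι̃ ∘ Φ` (`inl_embed_eq_inr_embed`).
[cite: HawkingEllis1973CUP, §7.6, p. 250] -/
theorem inlZ_relative (h : ¬ 𝔠.HasCorrespondingBoundaryPoints) :
    ContMDiff (𝓡 (n + 1)) (𝓡 (n + 1)) ∞ (𝔠.inlZ h) ∧ IsOpenEmbedding (𝔠.inlZ h) ∧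
      𝒟₁.metric.IsIsometricImmersion (𝔠.gluedCauchyDevelopment h).metric.toPseudoRiemannianMetric
        (𝔠.inlZ h) ∧
      𝒟₁.timeOrientation.PreservesTimeOrientation (𝔠.inlZ h)
        (𝔠.gluedCauchyDevelopment h).timeOrientation ∧
      𝔠.inlZ h ∘ 𝒟₁.embed = (𝔠.gluedCauchyDevelopment h).embed ∘ Φ :=
  ⟨𝔠.glueData.contMDiff_inl, 𝔠.glueData.isOpenEmbedding_inl, 𝔠.isIsometricImmersion_inl,
    𝔠.preservesTimeOrientation_inl h, funext fun x ↦ 𝔠.inl_embed_eq_inr_embed x⟩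

/-- **`π j₁` extends `ψ`**: `π j₁ y = π j₂ (ψ y)` for `y ∈ U`. [cite: Sbierski2016AHP, §3.3, proof of Thm. 5 (the identification `p ∼ ψ(p)`)] -/
theorem inlZ_coe_eq_inrZ_map (h : ¬ 𝔠.HasCorrespondingBoundaryPoints) (y : 𝔠.opens) :
    𝔠.inlZ h y = 𝔠.inrZ h (𝔠.map y) :=
  (𝔠.inr_map y).symm

/-! ### Vacuum -/

/-- **The glued metric is Ricci flat when `g₁` and `g₂` are** (naturality of the Ricci tensor
under the local isometries `π j₁`, `π j₂`, `PseudoRiemannianMetric.ricci_comap_apply`, whose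
differentials are onto). [cite: Sbierski2016AHP, §3.3, proof of Thm. 5 ("Ricci-flat metric `g̃` on `M̃`")] -/
theorem isRicciFlat_gluedMetric (h₁ : 𝒟₁.toDataEmbedding.IsVacuum) (h₂ : 𝒟₂.toDataEmbedding.IsVacuum)
    [𝔠.gluedMetric.toPseudoRiemannianMetric.HasLeviCivita] :
    𝔠.gluedMetric.toPseudoRiemannianMetric.IsRicciFlat := by
  intro p
  haveI hLC : 𝒟₁.metric.toPseudoRiemannianMetric.HasLeviCivita :=
    𝒟₁.metric.toPseudoRiemannianMetric.hasLeviCivita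
  haveI hLC' : 𝒟₂.metric.toPseudoRiemannianMetric.HasLeviCivita :=
    𝒟₂.metric.toPseudoRiemannianMetric.hasLeviCivita
  obtain (⟨a, rfl⟩ | ⟨b, rfl⟩) := 𝔠.glueData.exists_inl_or_inr p
  · set gc := 𝔠.gluedMetric.toPseudoRiemannianMetric.comap
      PseudoRiemannianMetric.contMDiff_pullbackBilin_holds 𝔠.inl 𝔠.glueData.contMDiff_inl
      (fun a ↦ (𝔠.mfderiv_inl_bijective a).1) rfl with hgc_def
    haveI hgcLC : gc.HasLeviCivita := gc.hasLeviCivita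
    have hgc : gc = 𝒟₁.metric.toPseudoRiemannianMetric := 𝔠.comap_gluedMetric_inl
    refine LinearMap.ext fun V ↦ LinearMap.ext fun W ↦ ?_
    obtain ⟨Y₀, rfl⟩ := (𝔠.mfderiv_inl_bijective a).2 V
    obtain ⟨Z₀, rfl⟩ := (𝔠.mfderiv_inl_bijective a).2 W
    have key := PseudoRiemannianMetric.ricci_comap_apply 𝔠.gluedMetric.toPseudoRiemannianMetric
      PseudoRiemannianMetric.contMDiff_pullbackBilin_holds (Φ := 𝔠.inl) 𝔠.glueData.contMDiff_inl
      (fun a ↦ (𝔠.mfderiv_inl_bijective a).1) rfl a Y₀ Z₀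
    change 𝔠.gluedMetric.toPseudoRiemannianMetric.ricci (𝔠.inl a)
      (mfderiv (𝓡 (n + 1)) (𝓡 (n + 1)) 𝔠.inl a Y₀) (mfderiv (𝓡 (n + 1)) (𝓡 (n + 1)) 𝔠.inl a Z₀) = 0
    rw [← key, PseudoRiemannianMetric.ricci_congr_metric hgc hgcLC hLC, h₁ a]
    rfl
  · set gc := 𝔠.gluedMetric.toPseudoRiemannianMetric.comap
      PseudoRiemannianMetric.contMDiff_pullbackBilin_holds 𝔠.inr 𝔠.glueData.contMDiff_inr
      (fun b ↦ (𝔠.mfderiv_inr_bijective b).1) rfl with hgc_def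
    haveI hgcLC : gc.HasLeviCivita := gc.hasLeviCivita
    have hgc : gc = 𝒟₂.metric.toPseudoRiemannianMetric := 𝔠.comap_gluedMetric_inr
    refine LinearMap.ext fun V ↦ LinearMap.ext fun W ↦ ?_
    obtain ⟨Y₀, rfl⟩ := (𝔠.mfderiv_inr_bijective b).2 V
    obtain ⟨Z₀, rfl⟩ := (𝔠.mfderiv_inr_bijective b).2 W
    have key := PseudoRiemannianMetric.ricci_comap_apply 𝔠.gluedMetric.toPseudoRiemannianMetric
      PseudoRiemannianMetric.contMDiff_pullbackBilin_holds (Φ := 𝔠.inr) 𝔠.glueData.contMDiff_inr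
      (fun b ↦ (𝔠.mfderiv_inr_bijective b).1) rfl b Y₀ Z₀
    change 𝔠.gluedMetric.toPseudoRiemannianMetric.ricci (𝔠.inr b)
      (mfderiv (𝓡 (n + 1)) (𝓡 (n + 1)) 𝔠.inr b Y₀) (mfderiv (𝓡 (n + 1)) (𝓡 (n + 1)) 𝔠.inr b Z₀) = 0
    rw [← key, PseudoRiemannianMetric.ricci_congr_metric hgc hgcLC hLC', h₂ b]
    rfl

end RelCommonDevelopment

end CauchyDevelopment

/-! ### Vacuum developments: the gluing input of the localisation principle -/

namespace VacuumCauchyDevelopment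

/-- **The glued vacuum Cauchy development** of the larger datum, from a vacuum development of a
sub-datum and a vacuum development of the datum glued along a relative common development without
corresponding boundary points. [cite: HawkingEllis1973CUP, §7.6, p. 250] -/
def relGluedVacuumCauchyDevelopment (𝒟₁ : VacuumCauchyDevelopment D₁)
    (𝒟₂ : VacuumCauchyDevelopment D₂) {Φ : N → X}
    (𝔠 : CauchyDevelopment.RelCommonDevelopment 𝒟₁.toCauchyDevelopment 𝒟₂.toCauchyDevelopment Φ)
    (h : ¬ 𝔠.HasCorrespondingBoundaryPoints) : VacuumCauchyDevelopment D₂ where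
  toCauchyDevelopment := 𝔠.gluedCauchyDevelopment h
  isRicciFlat := by
    intro inst
    haveI : 𝔠.gluedMetric.toPseudoRiemannianMetric.HasLeviCivita := inst
    exact 𝔠.isRicciFlat_gluedMetric 𝒟₁.isVacuum 𝒟₂.isVacuum

/-- **The gluing input of the localisation principle** (Hawking–Ellis 1973, §7.6, p. 250;
Choquet-Bruhat–Geroch 1969, p. 334; relative form of Sbierski 2016, §3.3): let `𝒟₁` be a vacuum
Cauchy development of data `D₁` on `N`, `𝒟₂` one of data `D₂` on `X`, and `𝔠 = (U, ψ)` a relative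
common development over `Φ : N → X` WITHOUT corresponding boundary points. Then there are a vacuum
Cauchy development `Z` of `D₂` (the gluing `M₂ ∪_ψ M₁`), an embedding of developments
`jZ : 𝒟₂ → Z` and a smooth isometric time-orientation preserving open embedding `j' : M₁ → Z`
over `Φ` (`j' ∘ ι₁ = ι_Z ∘ Φ`) with `j' = jZ ∘ ψ` on `U`. [cite: HawkingEllis1973CUP, §7.6, p. 250] -/
theorem exists_relative_extension_of_not_hasCorrespondingBoundaryPoints
    (𝒟₁ : VacuumCauchyDevelopment D₁) (𝒟₂ : VacuumCauchyDevelopment D₂) {Φ : N → X}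
    (𝔠 : CauchyDevelopment.RelCommonDevelopment 𝒟₁.toCauchyDevelopment 𝒟₂.toCauchyDevelopment Φ)
    (h : ¬ 𝔠.HasCorrespondingBoundaryPoints) :
    ∃ (Z : VacuumCauchyDevelopment.{u} D₂) (jZ : 𝒟₂.carrier → Z.carrier)
      (j' : 𝒟₁.carrier → Z.carrier),
      (ContMDiff (𝓡 (n + 1)) (𝓡 (n + 1)) ∞ jZ ∧ IsOpenEmbedding jZ ∧
        𝒟₂.metric.IsIsometricImmersion Z.metric.toPseudoRiemannianMetric jZ ∧
        𝒟₂.timeOrientation.PreservesTimeOrientation jZ Z.timeOrientation ∧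
        jZ ∘ 𝒟₂.embed = Z.embed) ∧
      (ContMDiff (𝓡 (n + 1)) (𝓡 (n + 1)) ∞ j' ∧ IsOpenEmbedding j' ∧
        𝒟₁.metric.IsIsometricImmersion Z.metric.toPseudoRiemannianMetric j' ∧
        𝒟₁.timeOrientation.PreservesTimeOrientation j' Z.timeOrientation ∧
        j' ∘ 𝒟₁.embed = Z.embed ∘ Φ) ∧
      ∀ y : 𝔠.opens, j' y = jZ (𝔠.map y) :=
  ⟨relGluedVacuumCauchyDevelopment 𝒟₁ 𝒟₂ 𝔠 h, 𝔠.inrZ h, 𝔠.inlZ h, 𝔠.inrZ_embeds h,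
    𝔠.inlZ_relative h, 𝔠.inlZ_coe_eq_inrZ_map h⟩

end VacuumCauchyDevelopment

end Developments

end Literature.Geometry.Lorentzian

end
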